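import Literature.NumberTheory.EllipticCurves.PeriodIndexKummerIndex
import HarnessLib

/-!
# The index `P²` of all differences `η_i - η_j` (Clark–Sharif 2010, Theorem 2, §3.6):
# packaging the one-prime theorem over a sequence of primes

Topic `NumberTheory/EllipticCurves`; theorems only. For a sequence of Kummer pairs
`(a_m, b_m) ∈ kˣ × kˣ` and, for each `m`, a prime `𝔓_m` (above a good place `v_m ∤ p`, with a
local arithmetic Frobenius) at which Clark–Sharif's conditions hold in Galois form — `D_{𝔓_m}`
inside `𝔤_k` ((SC5′)), the norm cocycles `Θ(a_i, b_i)` of all LATER indices `i > m` vanishing on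
`D_{𝔓_m}` ((SC3′)), and `Θ(a_m, b_m)` having first coordinate onto and second coordinate zero on
the inertia group and a unit second coordinate at Frobenius ((SC4′) with Lemma 18's choice of
`b_m`), plus (SC2′) — every difference `η_i - η_j`, `i ≠ j`, of the classes
`η_m = (E[P] ⊂ E)_* cores Φ(a_m, b_m)` has index `P²`
(`index_resH1Hom_coresH1_kummerPhi_sub_eq_sq` at `m = min(i, j)`, and `index_neg`). This is
hypothesis (ii) of `ClarkSharif2010_thm2_of_kummerClasses` (`PeriodIndexThm2Reduction`); what it
leaves to prove of Theorem 2 is the EXISTENCE of such pairs and primes (Clark–Sharif's Lemma 14: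
principal primes with generators satisfying congruences, by class field theory and Chebotarev)
and the local `P`-th power conditions at the prescribed finite places (Hensel).

## References

* P. L. Clark, S. Sharif, *Period, index and potential Ш*, Algebra & Number Theory 4 (2010)
  151–174, §§3.4–3.6 (`ClarkSharif2010`).
-/

noncomputable section

open scoped Classical Pointwise
open NumberField IsDedekindDomain Field
open Literature.NumberTheory.GaloisRepresentations IsDedekindDomain.HeightOneSpectrum

universe u

namespace Literature.NumberTheory.EllipticCurves

variable {K : Type u} [Field K] [NumberField K] (W : WeierstrassCurve K) [W.IsElliptic]
variable {k : IntermediateField K (AlgebraicClosure K)} {P : ℕ} [NeZero P] {ζ : AlgebraicClosure K}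

/-- **Clark–Sharif 2010, Theorem 2, hypothesis (ii) of `ClarkSharif2010_thm2_of_kummerClasses`
from per-prime Kummer data.** See the module docstring; `ρ` is a bijection `(ℤ/P)² ≅ E[P]`, and
the conditions at the `m`-th prime are stated through values `Θ(a, b)(σ) = ρ(c₁, c₂)` of the norm
cocycles `Θ(a, b) = Σ_x (s x)·Φ(a, b)`. [cite: ClarkSharif2010, Theorem 2 (§3.6)] -/
theorem index_sub_eq_sq_of_kummerData
    (hN : IsOpen (fixingGal k : Set (absoluteGaloisGroup K))) [(fixingGal k).Normal]
    [Fintype (absoluteGaloisGroup K ⧸ fixingGal k)]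
    (hζ : IsPrimitiveRoot ζ P) (hζk : ζ ∈ k)
    (htriv : ∀ (g : fixingGal k) (m : ↥(WeierstrassCurve.geomTorsion W (P : ℤ))), g • m = m)
    (ρ : ZMod P × ZMod P →+ ↥(WeierstrassCurve.geomTorsion W (P : ℤ))) (hρ : Function.Bijective ρ)
    {s : absoluteGaloisGroup K ⧸ fixingGal k → absoluteGaloisGroup K}
    (hs : ∀ x, (s x : absoluteGaloisGroup K ⧸ fixingGal k) = x)
    {p n : ℕ} [Fact p.Prime] (hP : P = p ^ n)
    -- the primes
    (v : ℕ → HeightOneSpectrum (𝓞 K)) (hp : ∀ m, (p : 𝓞 K) ∉ (v m).asIdeal)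
    (hv : ∀ m, W.HasGoodReductionAt (v m))
    (𝔐 : ∀ m, Ideal (localAbsIntegers (v m))) (h𝔐 : ∀ m, 𝔐 m ∈ (v m).localPrimesAbove)
    (ι : ∀ m, AlgebraicClosure K →ₐ[K] AlgebraicClosure ((v m).adicCompletion K))
    (σL : ∀ m, absoluteGaloisGroup ((v m).adicCompletion K))
    (hσL : ∀ m, IsArithFrobAt ((v m).adicCompletionIntegers K) (σL m) (𝔐 m))
    (hDN : ∀ m, ((v m).primeBelow (ι m) (𝔐 m)).decompositionSubgroup (absoluteGaloisGroup K) ≤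
      fixingGal k)
    -- the pairs
    (a b : ℕ → (↥k)ˣ)
    (hfar : ∀ m i, m < i → ∀ σ
      (hσ : σ ∈ ((v m).primeBelow (ι m) (𝔐 m)).decompositionSubgroup (absoluteGaloisGroup K)),
      (∑ x, conjCocycle (fixingGal k) (s x) (kummerPhiCocycle hζ hζk htriv ρ (a i) (b i))).1
        ⟨σ, hDN m hσ⟩ = 0)
    (honto : ∀ m (c : ZMod P), ∃ (σ : absoluteGaloisGroup K)
      (hσ : σ ∈ ((v m).primeBelow (ι m) (𝔐 m)).decompositionSubgroup (absoluteGaloisGroup K)),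
      σ ∈ ((v m).primeBelow (ι m) (𝔐 m)).inertia (absoluteGaloisGroup K) ∧ ∃ c₂ : ZMod P,
        (∑ x, conjCocycle (fixingGal k) (s x) (kummerPhiCocycle hζ hζk htriv ρ (a m) (b m))).1
          ⟨σ, hDN m hσ⟩ = ρ (c, c₂))
    (hzero : ∀ m σ
      (hσ : σ ∈ ((v m).primeBelow (ι m) (𝔐 m)).decompositionSubgroup (absoluteGaloisGroup K)),
      σ ∈ ((v m).primeBelow (ι m) (𝔐 m)).inertia (absoluteGaloisGroup K) → ∃ c₁ : ZMod P,
        (∑ x, conjCocycle (fixingGal k) (s x) (kummerPhiCocycle hζ hζk htriv ρ (a m) (b m))).1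
          ⟨σ, hDN m hσ⟩ = ρ (c₁, 0))
    (hunit : ∀ m (hφ : resGalOfEmb (ι m) (σL m) ∈
      ((v m).primeBelow (ι m) (𝔐 m)).decompositionSubgroup (absoluteGaloisGroup K)),
      ∃ c₁ c₂ : ZMod P, IsUnit c₂ ∧
        (∑ x, conjCocycle (fixingGal k) (s x) (kummerPhiCocycle hζ hζk htriv ρ (a m) (b m))).1
          ⟨resGalOfEmb (ι m) (σL m), hDN m hφ⟩ = ρ (c₁, c₂))
    -- the junk root and (SC2′)
    (hjunk : ∃ c : WeierstrassCurve.geomPoints W, (∀ g ∈ fixingGal k, g • c = c) ∧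
      P • c = (P * (P - 1) / 2) • ((ρ (1, 0) : ↥(WeierstrassCurve.geomTorsion W (P : ℤ))) :
        WeierstrassCurve.geomPoints W))
    (hSC2 : ∀ m (x : WeierstrassCurve.geomPoints W), (∀ σ : absoluteGaloisGroup K, σ • x = x) →
      ∃ y : WeierstrassCurve.geomPoints W,
        (∀ σ ∈ ((v m).primeBelow (ι m) (𝔐 m)).decompositionSubgroup (absoluteGaloisGroup K),
          σ • y = y) ∧ P • y = x) :
    ∀ i j, i ≠ j →
      index W
        (resH1Hom (ContinuousMonoidHom.id (absoluteGaloisGroup K))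
            (WeierstrassCurve.geomTorsion W (P : ℤ)).subtype (geomTorsion_subtype_smul W P)
            (coresH1 (fixingGal k) hN (kummerPhi hζ hζk htriv ρ (a i) (b i))) -
          resH1Hom (ContinuousMonoidHom.id (absoluteGaloisGroup K))
            (WeierstrassCurve.geomTorsion W (P : ℤ)).subtype (geomTorsion_subtype_smul W P)
            (coresH1 (fixingGal k) hN (kummerPhi hζ hζk htriv ρ (a j) (b j)))) = P ^ 2 := by
  -- the ordered statement: index (η_i - η_m) = P² for m < i, analysed at the m-th prime
  have key : ∀ m i, m < i →
      index W
        (resH1Hom (ContinuousMonoidHom.id (absoluteGaloisGroup K))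
            (WeierstrassCurve.geomTorsion W (P : ℤ)).subtype (geomTorsion_subtype_smul W P)
            (coresH1 (fixingGal k) hN (kummerPhi hζ hζk htriv ρ (a i) (b i))) -
          resH1Hom (ContinuousMonoidHom.id (absoluteGaloisGroup K))
            (WeierstrassCurve.geomTorsion W (P : ℤ)).subtype (geomTorsion_subtype_smul W P)
            (coresH1 (fixingGal k) hN (kummerPhi hζ hζk htriv ρ (a m) (b m)))) = P ^ 2 := by
    intro m i hmi
    -- the coordinate characters at the `m`-th prime
    set e := Equiv.ofBijective ρ hρ with he
    set Θ := ∑ x, conjCocycle (fixingGal k) (s x) (kummerPhiCocycle hζ hζk htriv ρ (a m) (b m)) with hΘ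
    set χ₁ : ↥(((v m).primeBelow (ι m) (𝔐 m)).decompositionSubgroup (absoluteGaloisGroup K)) → ZMod P :=
      fun σ ↦ (e.symm (Θ.1 ⟨σ, hDN m σ.2⟩)).1 with hχ₁
    set χ₂ : ↥(((v m).primeBelow (ι m) (𝔐 m)).decompositionSubgroup (absoluteGaloisGroup K)) → ZMod P :=
      fun σ ↦ (e.symm (Θ.1 ⟨σ, hDN m σ.2⟩)).2 with hχ₂
    have hχ : ∀ σ : ↥(((v m).primeBelow (ι m) (𝔐 m)).decompositionSubgroup (absoluteGaloisGroup K)),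
        Θ.1 ⟨σ, hDN m σ.2⟩ = ρ (χ₁ σ, χ₂ σ) := by
      intro σ
      simp only [hχ₁, hχ₂, Prod.mk.eta]
      exact (e.apply_symm_apply _).symm
    have hcoord : ∀ (σ : ↥(((v m).primeBelow (ι m) (𝔐 m)).decompositionSubgroup (absoluteGaloisGroup K)))
        (c₁ c₂ : ZMod P), Θ.1 ⟨σ, hDN m σ.2⟩ = ρ (c₁, c₂) → χ₁ σ = c₁ ∧ χ₂ σ = c₂ := by
      intro σ c₁ c₂ h
      rw [hχ σ] at h
      have h2 := hρ.1 h
      exact ⟨congrArg Prod.fst h2, congrArg Prod.snd h2⟩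
    obtain ⟨c, hcN, hcP⟩ := hjunk
    refine index_resH1Hom_coresH1_kummerPhi_sub_eq_sq W hN hζ hζk htriv ρ hρ.1 hs hP (hp m) (hv m)
      (h𝔐 m) (ι m) (hσL m) (hDN m) (a i) (b i) (a m) (b m) (hfar m i hmi) χ₁ χ₂ hχ ?_ ?_ ?_
      ⟨c, fun σ hσ ↦ hcN σ (hDN m hσ), hcP⟩ (hSC2 m)
    · intro c₀
      obtain ⟨σ, hσD, hσI, c₂, hc⟩ := honto m c₀
      exact ⟨⟨σ, hσD⟩, hσI, (hcoord ⟨σ, hσD⟩ c₀ c₂ hc).1⟩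
    · intro σ hσI
      obtain ⟨c₁, hc⟩ := hzero m σ σ.2 hσI
      exact (hcoord σ c₁ 0 hc).2
    · intro hφ
      obtain ⟨c₁, c₂, hu, hc⟩ := hunit m hφ
      rw [(hcoord ⟨_, hφ⟩ c₁ c₂ hc).2]
      exact hu
  intro i j hij
  rcases lt_or_gt_of_ne hij with h | h
  · rw [← index_neg, neg_sub]
    exact key i j h
  · exact key j i h

end Literature.NumberTheory.EllipticCurves
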